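import Literature.Barriers.CriticalPhenomena.TimarGoodProbability
import HarnessLib

/-!
# Timár 2006, proof of Thm. 4.3: "the open component of `o` in `B_o(i; r)` is good with
# probability `> q/2`" — PROVED

Barrier catalogue `Literature/Barriers/CriticalPhenomena/`; continues `TimarGoodProbability.lean`
towards `Timar2006_noInfiniteLightClusters_holds`. Á. Timár, Ann. Probab. 34 (2006)
2344–2364, proof of Thm. 4.3, p. 2354:

> "From Lemma 4.2, we know that given the event that `C(o)` is nice and light, with probability
> arbitrarily close to 1, `|C(o) ∩ G(ℓ_{i+1}, ℓ_i]| ≥ k` if `i` is sufficiently large. Hence, for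
> any `k`, there exist an `i` and an `r ∈ ℕ` such that the open component of `o` in `B_o(i; r)`
> is good with probability `> q/2`. (First, we choose `i`, using Lemma 4.2, to satisfy the first
> property for being good. Then we choose `r` to satisfy the second property. This can always be
> done since the intersection of a light cluster with `G(ℓ_{j+i}, ℓ_j]` is finite by definition
> and thus the probability that it intersects a large sphere around `o` can be made arbitrarily
> small.)"

`exists_measure_nice_le_timarGood_add`: for Bernoulli(`p`) bond percolation with `0 < p < 1` on a
connected, locally finite, transitive nonunimodular graph, for every `k` and `δ > 0` there are a
depth `n` and a radius `r` with
`P_p(C(o) infinite, light and nice) ≤ P_p(timarGood o; n, r, k) + δ`.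
Ingredients: Lemma 4.2 in its summable form (`tsum_slabFewEvent_ne_top`: `P(1 ≤ |C_j ∩ L_j| < M₀)
→ 0`), the ball exhaustion (`eventually_measure_inter_not_subset_graphBall_le`), the conditional
binomial estimate for the open long edges (`bondPercolation_real_manySlab_fewOpen_le`), and the
deterministic inclusions of `TimarNiceEvent.lean`.

## References

* Á. Timár, Ann. Probab. 34 (2006) 2344–2364 (arXiv:math/0702875), §4, Lemma 4.2 and the proof
  of Thm. 4.3, p. 2354. [Timar2006]
-/

noncomputable section

namespace Literature.Barriers.CriticalPhenomena

open _root_.MeasureTheory _root_.Filter Literature.Probability.Percolation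
open scoped _root_.ENNReal _root_.Topology

variable {V : Type*}

section Main

variable {G : SimpleGraph V} [G.LocallyFinite] {o : V} (hconn : G.Connected)
  (htr : IsGraphTransitive G) (hU : ¬ IsGraphUnimodular G) [Countable V]
include hconn htr hU

omit [Countable V] in
open Classical in
/-- **The deterministic core of "good with probability `> q/2`"**: fix long edges `{y, st y}`,
a depth `n`, a radius `r`, a count `k` and a size `M₀`. A configuration on `E(G)` whose cluster
`C(o)` is infinite, light and nice, and which is NOT good, falls into one of four exceptional
events: the part of `C(o)` above `Δ^{n+3}` leaves `B(o, r+1)`; the part above `Δ^{n+2}` leaves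
`B(o, r)`; `1 ≤ |C_{n+1} ∩ L_{n+1}| < M₀` (Lemma 4.2's event); or `|C_{n+1} ∩ L_{n+1}| ≥ M₀` but
fewer than `k` of its long edges are open. [cite: Timar2006, §4 (proof of Thm. 4.3, p. 2354)] -/
theorem nice_subset_timarGood_union {st : V → V} (hst : ∀ y, G.Adj y (st y) ∧
      autWeight G o (st y) = minNbrWeight G o * autWeight G o y) (n r k M₀ : ℕ)
    {ω : BondConfig V} (hω : ω ⊆ G.edgeSet) (hinf : (openCluster ω o).Infinite)
    (hlight : ¬ IsHeavy G o (openCluster ω o))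
    (hnice : openCluster ω o ⊆ insert o {v | autWeight G o v ≤ minNbrWeight G o}) :
    ω ∈ timarGood G o n r k o ∪
      {ω | ¬ IsHeavy G o (openCluster ω o)} ∩ {ω | ¬ (openCluster ω o ∩
          {v | minNbrWeight G o ^ (n + 3) < autWeight G o v} ⊆ graphBall G o (r + 1))} ∪
      {ω | ¬ IsHeavy G o (openCluster ω o)} ∩ {ω | ¬ (openCluster ω o ∩
          {v | minNbrWeight G o ^ (n + 2) < autWeight G o v} ⊆ graphBall G o r)} ∪
      slabFewEvent G o (fun i => minNbrWeight G o ^ i) M₀ (n + 1) ∪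
      ({ω | (regionCluster G o (fun i => minNbrWeight G o ^ i) (n + 1) ω ∩
            tslab G o (fun i => minNbrWeight G o ^ i) (n + 1)).Finite ∧
          M₀ ≤ (regionCluster G o (fun i => minNbrWeight G o ^ i) (n + 1) ω ∩
            tslab G o (fun i => minNbrWeight G o ^ i) (n + 1)).ncard} ∩
        {ω | ((slabStat G o (fun i => minNbrWeight G o ^ i) (n + 1) ω).filter
          fun y => s(y, st y) ∈ ω).card < k}) := by
  set t : ℕ → ℝ≥0∞ := fun i => minNbrWeight G o ^ i with ht
  have hsep : ∀ j, t (j + 1) ≤ minNbrWeight G o * t j := fun j => by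
    simp only [ht, pow_succ, mul_comm]; exact le_rfl
  have ht0 : ∀ j, t j ≠ 0 := fun j => pow_ne_zero j (minNbrWeight_ne_zero hconn o)
  have ht1 : t 1 < 1 := by simp only [ht, pow_one]; exact minNbrWeight_lt_one hconn htr hU o
  have ho : o ∈ tregion G o t (n + 1) := mem_tregion_self hconn htr hU hsep ht1 (n + 1)
  by_cases hb1 : openCluster ω o ∩ {v | minNbrWeight G o ^ (n + 3) < autWeight G o v} ⊆
      graphBall G o (r + 1)
  swap
  · exact Or.inl (Or.inl (Or.inl (Or.inr ⟨hlight, hb1⟩)))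
  have hseal := timarSealed_of_nice (n := n) hconn hnice hb1
  by_cases hcount : (k : ℕ∞) ≤ (timarCountSet G o n r o ω).encard
  · exact Or.inl (Or.inl (Or.inl (Or.inl ⟨hseal, hcount⟩)))
  by_cases hb2 : openCluster ω o ∩ {v | minNbrWeight G o ^ (n + 2) < autWeight G o v} ⊆
      graphBall G o r
  swap
  · exact Or.inl (Or.inl (Or.inr ⟨hlight, hb2⟩))
  have hsub := subset_timarCountSet_of_nice (n := n) hconn htr hU hnice hb2
  set X : Set V := regionCluster G o t (n + 1) ω ∩ tslab G o t (n + 1) with hX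
  have hXfin : X.Finite := by
    refine (finite_inter_of_not_isHeavy hlight (ht0 (n + 2))).subset ?_
    rintro y ⟨hyR, -⟩
    exact ⟨regionCluster_subset_openCluster (n + 1) ω hyR,
      show t (n + 2) ≤ autWeight G o y from le_of_lt (regionCluster_subset_tregion ho ω hyR)⟩
  have hXne : X.Nonempty := regionCluster_inter_tslab_nonempty hconn htr hU hsep ho hω
    (not_subset_tregion_of_light ht0 hinf hlight)
  by_cases hM : M₀ ≤ X.ncard
  swap
  · -- Lemma 4.2's event: `1 ≤ |X| < M₀`
    refine Or.inl (Or.inr ⟨Set.one_le_encard_iff_nonempty.2 hXne, ?_⟩)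
    rw [← hXfin.cast_ncard_eq]
    exact_mod_cast not_le.1 hM
  · -- many slab vertices but few open long edges
    refine Or.inr ⟨⟨hXfin, hM⟩, ?_⟩
    show ((slabStat G o t (n + 1) ω).filter fun y => s(y, st y) ∈ ω).card < k
    have hF : (↑((slabStat G o t (n + 1) ω).filter fun y => s(y, st y) ∈ ω) : Set V) ⊆
        {y | y ∈ X ∧ TimarSteepOpen G o y ω} := by
      intro y hy
      rw [Finset.coe_filter] at hy
      obtain ⟨hyΨ, hopen⟩ := hy
      refine ⟨?_, st y, (hst y).1, (hst y).2, hopen⟩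
      rw [hX, ← coe_slabStat_of_finite hXfin]
      exact Finset.mem_coe.2 hyΨ
    have hlt : ({y | y ∈ X ∧ TimarSteepOpen G o y ω} : Set V).encard < k :=
      lt_of_le_of_lt (Set.encard_le_encard hsub) (not_le.1 hcount)
    have h2 := lt_of_le_of_lt (Set.encard_le_encard hF) hlt
    rw [Set.encard_coe_eq_coe_finsetCard] at h2
    exact_mod_cast h2

/-- **"The open component of `o` in `B_o(i; r)` is good with probability `> q/2`"** (p. 2354),
quantitative form: for `0 < p < 1`, every `k` and every `δ > 0` there are a depth `n` and a
radius `r` such that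
`P_p(C(o) infinite, light, nice) ≤ P_p(timarGood o; n, r, k) + δ`.
[cite: Timar2006, §4 (proof of Thm. 4.3, p. 2354: the choice of i and r)] -/
theorem exists_measure_nice_le_timarGood_add {p : unitInterval} (hp0 : 0 < (p : ℝ))
    (hp1 : (p : ℝ) < 1) (k : ℕ) {δ : ℝ} (hδ : 0 < δ) :
    ∃ n r : ℕ, bondPercolation G p {ω | (openCluster ω o).Infinite ∧
        ¬ IsHeavy G o (openCluster ω o) ∧
        openCluster ω o ⊆ insert o {v | autWeight G o v ≤ minNbrWeight G o}} ≤
      bondPercolation G p (timarGood G o n r k o) + ENNReal.ofReal δ := by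
  classical
  set P := bondPercolation G p with hP
  -- long edges
  have hst' : ∀ y : V, ∃ u, G.Adj y u ∧ autWeight G o u = minNbrWeight G o * autWeight G o y :=
    fun y => exists_adj_autWeight_eq_mul hconn htr hU o y
  choose st hst using hst'
  -- the grid
  set t : ℕ → ℝ≥0∞ := fun i => minNbrWeight G o ^ i with ht
  have hsep : ∀ j, t (j + 1) ≤ minNbrWeight G o * t j := fun j => by
    simp only [ht, pow_succ, mul_comm]; exact le_rfl
  have ht1 : t 1 < 1 := by simp only [ht, pow_one]; exact minNbrWeight_lt_one hconn htr hU o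
  have hδ4 : 0 < δ / 4 := by linarith
  have hδ4E : 0 < ENNReal.ofReal (δ / 4) := ENNReal.ofReal_pos.2 hδ4
  -- (1) the size `M₀` beyond which few open long edges are unlikely
  obtain ⟨M₀, hM₀⟩ := eventually_atTop.1 (eventually_fewOpenBound_le hp0 k hδ4)
  -- (2) the depth `n`: Lemma 4.2 (summable form)
  have hlim := ENNReal.tendsto_atTop_zero_of_tsum_ne_top
    (tsum_slabFewEvent_ne_top hconn htr hU hsep ht1 hp1 M₀)
  obtain ⟨N, hN⟩ := eventually_atTop.1 (hlim.eventually (eventually_le_nhds hδ4E))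
  set n := N with hn
  -- (3) the radius `r`: ball exhaustion on the light event
  have hL : MeasurableSet {ω : BondConfig V | ¬ IsHeavy G o (openCluster ω o)} :=
    (measurableSet_isHeavy_openCluster G o o).compl
  have hfin : ∀ m : ℕ, ∀ ω ∈ {ω : BondConfig V | ¬ IsHeavy G o (openCluster ω o)},
      (openCluster ω o ∩ {v | minNbrWeight G o ^ m < autWeight G o v}).Finite := by
    intro m ω hω
    refine (finite_inter_of_not_isHeavy hω (pow_ne_zero m (minNbrWeight_ne_zero hconn o))).subset ?_
    rintro v ⟨hvC, hv⟩
    exact ⟨hvC, show minNbrWeight G o ^ m ≤ autWeight G o v from le_of_lt hv⟩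
  obtain ⟨R₁, hR₁⟩ := eventually_atTop.1 (eventually_measure_inter_not_subset_graphBall_le hconn o
    P hL {v | minNbrWeight G o ^ (n + 3) < autWeight G o v} (hfin (n + 3)) hδ4E)
  obtain ⟨R₂, hR₂⟩ := eventually_atTop.1 (eventually_measure_inter_not_subset_graphBall_le hconn o
    P hL {v | minNbrWeight G o ^ (n + 2) < autWeight G o v} (hfin (n + 2)) hδ4E)
  set r := max R₁ R₂ with hr
  refine ⟨n, r, ?_⟩
  -- (4) the four exceptional events and their probabilities
  set S₁ := {ω : BondConfig V | ¬ IsHeavy G o (openCluster ω o)} ∩ {ω | ¬ (openCluster ω o ∩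
      {v | minNbrWeight G o ^ (n + 3) < autWeight G o v} ⊆ graphBall G o (r + 1))} with hS₁
  set S₂ := {ω : BondConfig V | ¬ IsHeavy G o (openCluster ω o)} ∩ {ω | ¬ (openCluster ω o ∩
      {v | minNbrWeight G o ^ (n + 2) < autWeight G o v} ⊆ graphBall G o r)} with hS₂
  set S₃ := slabFewEvent G o t M₀ (n + 1) with hS₃
  set S₄ := {ω : BondConfig V | (regionCluster G o t (n + 1) ω ∩ tslab G o t (n + 1)).Finite ∧
      M₀ ≤ (regionCluster G o t (n + 1) ω ∩ tslab G o t (n + 1)).ncard} ∩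
    {ω | ((slabStat G o t (n + 1) ω).filter fun y => s(y, st y) ∈ ω).card < k} with hS₄
  have h1 : P S₁ ≤ ENNReal.ofReal (δ / 4) := hR₁ (r + 1) (by omega)
  have h2 : P S₂ ≤ ENNReal.ofReal (δ / 4) := hR₂ r (le_max_right _ _)
  have h3 : P S₃ ≤ ENNReal.ofReal (δ / 4) := hN (n + 1) (by omega)
  have h4 : P S₄ ≤ ENNReal.ofReal (δ / 4) := by
    have hreal := bondPercolation_real_manySlab_fewOpen_le hconn htr hU p (fun y => (hst y).1)
      (fun y => (hst y).2) n k M₀ hδ4.le hM₀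
    calc P S₄ = ENNReal.ofReal (P.real S₄) := (ENNReal.ofReal_toReal (measure_ne_top _ _)).symm
      _ ≤ ENNReal.ofReal (δ / 4) := ENNReal.ofReal_le_ofReal hreal
  -- (5) the inclusion, almost surely (configurations live on `E(G)`)
  have hωE : ∀ᵐ ω ∂P, ω ⊆ G.edgeSet := ProbabilityTheory.setBernoulli_ae_subset
  have hincl : {ω | (openCluster ω o).Infinite ∧ ¬ IsHeavy G o (openCluster ω o) ∧
        openCluster ω o ⊆ insert o {v | autWeight G o v ≤ minNbrWeight G o}} ≤ᵐ[P]
      (timarGood G o n r k o ∪ S₁ ∪ S₂ ∪ S₃ ∪ S₄ : Set (BondConfig V)) := by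
    refine hωE.mono fun ω hω hmem => ?_
    exact nice_subset_timarGood_union hconn htr hU hst n r k M₀ hω hmem.1 hmem.2.1 hmem.2.2
  calc P _ ≤ P (timarGood G o n r k o ∪ S₁ ∪ S₂ ∪ S₃ ∪ S₄) := measure_mono_ae hincl
    _ ≤ P (timarGood G o n r k o) + P S₁ + P S₂ + P S₃ + P S₄ := by
        refine (measure_union_le _ _).trans ?_
        gcongr
        refine (measure_union_le _ _).trans ?_
        gcongr
        refine (measure_union_le _ _).trans ?_
        gcongr
        exact measure_union_le _ _
    _ ≤ P (timarGood G o n r k o) + ENNReal.ofReal (δ / 4) + ENNReal.ofReal (δ / 4) +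
          ENNReal.ofReal (δ / 4) + ENNReal.ofReal (δ / 4) := by gcongr
    _ = P (timarGood G o n r k o) + ENNReal.ofReal δ := by
        have hsum : ENNReal.ofReal (δ / 4) + ENNReal.ofReal (δ / 4) + ENNReal.ofReal (δ / 4) +
            ENNReal.ofReal (δ / 4) = ENNReal.ofReal δ := by
          rw [← ENNReal.ofReal_add (by positivity) (by positivity),
            ← ENNReal.ofReal_add (by positivity) (by positivity),
            ← ENNReal.ofReal_add (by positivity) (by positivity)]
          congr 1
          ring
        rw [← hsum]
        ring

end Main

end Literature.Barriers.CriticalPhenomena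

end
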